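import Summits.Ventures.PercRepro.S1JointPerFlat3
import Summits.Ventures.PercRepro.S1FourSetsLower

/-!
# PercRepro — S1 PROPOSITION A WITH LEVER L1: the rank-`4` four-sets counted exactly (p2, gen 15; SUBCLAIM-S1 §6.3 (i))

`S1JointPerFlat3.ncard_eRk_eq_four_ncard_le_le_K` counted the size-`4` members of `U(p, 4)` as all `C(n, 4)`
four-subsets; with `S1FourSetsLower.ncard_four_sets_rank_four_add_le` they are at most `C(n, 4) − s₃(n − 3) − s₄`.
Stated additively in `ℕ`:

* **`ncard_eRk_eq_four_ncard_le_le_L1`** — `7560·#{B : r(B) = 4, |B| ≤ d} + 7560·(s₃(n − 3) + s₄) ≤ 7560·C(n, 4) +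
  RSK d·Π′_all + (RBK d − RSK d)·Π′_{S₀}`.
Axioms: standard.
-/

open scoped Matroid

namespace PercRepro

namespace S1

open Set

variable {α : Type}

/-- **PROPOSITION A, LEMMAS J + J′ + K + L1**: `7560·#{B ⊆ E : r(B) = 4, |B| ≤ d} + 7560·(s₃(n − 3) + s₄) ≤
7560·C(n, 4) + RSK d·Π′_all + (RBK d − RSK d)·Π′_{S₀}` — the `4`-sets of rank `4` counted as `C(n, 4)` minus the
dependent ones (`S1FourSetsLower`). -/
theorem ncard_eRk_eq_four_ncard_le_le_L1 (M : Matroid α) [M.Finite]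
    (hcirc : ∀ C, M.IsCircuit C → 3 ≤ C.encard)
    (hline : ∀ L ⊆ M.E, M.eRk L ≤ 2 → L.ncard ≤ 3) (hplane : ∀ P ⊆ M.E, M.eRk P ≤ 3 → P.ncard ≤ 6)
    (hten : ∀ X ⊆ M.E, M.eRk X ≤ 4 → X.ncard ≤ 10) {d : ℕ} (hd : M.E.encard = M.eRank + d) :
    7560 * {B : Set α | B ⊆ M.E ∧ M.eRk B = 4 ∧ B.ncard ≤ d}.ncard +
      7560 * ({C : Set α | M.IsCircuit C ∧ C.ncard = 3}.ncard * (M.E.ncard - 3) +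
        {C : Set α | M.IsCircuit C ∧ C.ncard = 4}.ncard) ≤
      7560 * M.E.ncard.choose 4 +
      RSK d * ({C : Set α | M.IsCircuit C ∧ C.ncard = 3}.ncard * (M.E.ncard - 3).choose 2 +
        {C : Set α | M.IsCircuit C ∧ C.ncard = 4}.ncard * (M.E.ncard - 4) +
        {C : Set α | M.IsCircuit C ∧ C.ncard = 5}.ncard) +
      (RBK d - RSK d) * ({C : Set α | M.IsCircuit C ∧ C.ncard = 3}.ncard * (min (5 * d) M.E.ncard - 3).choose 2 +
        {C : Set α | M.IsCircuit C ∧ C.ncard = 4}.ncard * (min (5 * d) M.E.ncard - 4) +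
        {C : Set α | M.IsCircuit C ∧ C.ncard = 5}.ncard) := by
  classical
  have hcore := ncard_rank4_Icc_le_K M hcirc hline hplane hten hd d
  set Ef := M.ground_finite.toFinset with hEf
  have hE : (Ef : Set α) = M.E := Set.Finite.coe_toFinset _
  have hEcard : Ef.card = M.E.ncard := (Set.ncard_eq_toFinset_card _ M.ground_finite).symm
  set S₁ := {B : Set α | B ⊆ M.E ∧ B.ncard = 4 ∧ M.eRk B = 4} with hS₁
  set S₂ := {B : Set α | B ⊆ M.E ∧ M.eRk B = 4 ∧ 5 ≤ B.ncard ∧ B.ncard ≤ d} with hS₂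
  have hsplit : {B : Set α | B ⊆ M.E ∧ M.eRk B = 4 ∧ B.ncard ≤ d} ⊆ S₁ ∪ S₂ := by
    intro B hB
    have hBfin : B.Finite := M.ground_finite.subset hB.1
    have hle : 4 ≤ B.ncard := by
      have := M.eRk_le_encard B
      rw [hB.2.1, ← hBfin.cast_ncard_eq] at this
      exact_mod_cast this
    rcases hle.lt_or_eq with h | h
    · exact Or.inr ⟨hB.1, hB.2.1, h, hB.2.2⟩
    · exact Or.inl ⟨hB.1, h.symm, hB.2.1⟩
  have hS₁fin : S₁.Finite := M.ground_finite.finite_subsets.subset (fun B hB => hB.1)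
  have hS₂fin : S₂.Finite := M.ground_finite.finite_subsets.subset (fun B hB => hB.1)
  have hS₁card := ncard_four_sets_rank_four_add_le M hline
  have h1 : 7560 * {B : Set α | B ⊆ M.E ∧ M.eRk B = 4 ∧ B.ncard ≤ d}.ncard ≤ 7560 * (S₁.ncard + S₂.ncard) :=
    calc 7560 * {B : Set α | B ⊆ M.E ∧ M.eRk B = 4 ∧ B.ncard ≤ d}.ncard
        ≤ 7560 * (S₁ ∪ S₂).ncard :=
          Nat.mul_le_mul_left _ (Set.ncard_le_ncard hsplit (hS₁fin.union hS₂fin))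
      _ ≤ 7560 * (S₁.ncard + S₂.ncard) := Nat.mul_le_mul_left _ (Set.ncard_union_le _ _)
  have h2 : 7560 * (S₁.ncard + ({C : Set α | M.IsCircuit C ∧ C.ncard = 3}.ncard * (M.E.ncard - 3) +
      {C : Set α | M.IsCircuit C ∧ C.ncard = 4}.ncard)) ≤ 7560 * M.E.ncard.choose 4 :=
    Nat.mul_le_mul_left _ hS₁card
  have := hcore
  rw [Nat.mul_add] at h1 h2
  omega

end S1

end PercRepro
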